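import Summits.Ventures.YMGap.YM3IR.BalabanSU2
import Summits.Ventures.YMGap.YM3IR.ForestWitness
import Summits.Ventures.YMGap.YM3IR.CovariantFamily
import Summits.Ventures.YMGap.YM3IR.AxialFamily
import Summits.Ventures.YMGap.YM3IR.ForestWitnessSUN
import Summits.Ventures.YMGap.RobustBall.WilsonOneStateConfinement
import Summits.Ventures.YMGap.RobustBall.WilsonStringTensionJoint
import Summits.Ventures.YMGap.RobustBall.OneStateLoops
import Summits.Ventures.YMGap.RobustBall.OneStateLimit
import Summits.Ventures.YMGap.RobustBall.RowsZdGMassive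
import Summits.Ventures.YMGap.Census.DecimationLowerBoundTwo
import HarnessLib

/-!
# Venture statement — YMGap (cell `pub-ymgap`) — CONJUNCT BODIES T29 (track Y4), T37, T38 (track Y2 / strong coupling: ONE STATE), T39 (track (b)) (seat p3-g5)

STATUS: BOOKED by the lead's PLAN amendment 58 (Sunday item (15), 2026-08-23T09:54Z): T29 := candidate C of seat ym3ir-theory-2's text
(`HOME/ym3ir/lean/T29-candidates-v3-theory2.lean` bc6fa882ef25c830: A = the INTERFACE form, B = the COVARIANT SUFFICIENT CONDITION, C = A ∧ B), taken
VERBATIM (parts `T29A_…`, `T29B_…`; the conjunct `T29_YM3Infrared := T29A ∧ T29B` is candidate C renamed); V19 = T29 + T37 + T38 + T39 (T38 booked on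
seat ds-3's one-line naming of its conjunct set). The index entry `YMGapStatementV1_9 := YMGapStatementV1_8 ∧ T29_YM3Infrared ∧ T37 ∧ T38 ∧ T39` is
appended to `StatementIndex.lean` (PLAN R215) after this file lands. Numbering T29 does not renumber T30–T36; T37–T39 are the next free numbers.

HONEST FRAMING (R196 vocabulary for T29, binding). WHAT THIS IS: bodies `Tk_… : Prop` + witnesses `Tk_…_holds` of FOUR conjuncts of the venture
statement (index of record: `Summits/Ventures/YMGap/Statement.lean` frozen at v1.6, continued in `StatementIndex.lean`), all kernel-checked with NO
hypothesis. T29 (`T29_YM3Infrared` + `T29_YM3Infrared_holds`) closes by TREE constants only (`YM3IR.massGap3Cofinal_su2_balaban_of_irConjecture3` — `YM3IR/BalabanSU2.lean`;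
`YM3IR.su2_irConjecture3_iff_massGap3Cofinal` — `YM3IR/ForestWitness.lean`; `YM3IR.massGap3Cofinal_su2_W_of_irConjecture3Cov` —
`YM3IR/CovariantFamily.lean`; `YM3IR.su2_covariance_clause_edges` — `YM3IR/AxialFamily.lean`; `YM3IR.su2_W_irConjecture3_iff_massGap3Cofinal`
— `YM3IR/ForestWitnessSUN.lean`). It is a typed INTERFACE / DICTIONARY between the UV track (Bałaban's `d = 3` theorems AS PRINTED, packaged
as the hypothesis `BalabanUV3 mk`), track Y2's certified robust balls, and the lattice infrared problem (`MassGap3Cofinal` = volume-uniform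
exponential clustering of the `d = 3` `SU(2)` Wilson laws along cofinal tori) — NOT a reduction of the mass gap:
* part (A) displays that, AS TYPED over a free measurable block family, the named infrared hypothesis `IRConjecture3` is EQUIVALENT to the
  conclusion on every unbounded coupling set (so `BalabanUV3` is logically idle in the arrow (A)(i));
* part (B) displays `IRConjecture3Cov` (ONE gauge-covariant, block-local family on ds-2's hypothesis-free tier-2 ball) as a SUFFICIENT
  condition — its converse is not known — together with the two kernel edges of the covariance clause (forest family NOT covariant, axial
  transport covariant) and, on the same ball, the equivalence of the UNPINNED hypothesis with the target.
WHAT THIS IS NOT: no new conjecture name, no continuum statement, nothing about `d = 4`, no mass gap at any coupling, no claim that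
`BalabanUV3` is load-bearing, no claim on the Yang–Mills Millennium problem; never «the remaining gap», never «reduces to».
Texts: seat ym3ir-theory-2 (countersign of these bytes requested); print locators Bałaban CMP 102 (1985) Thm 1 p. 257 / Thm 2 p. 272 and
CMP 98 (1985) (11), (15) p. 19 written as plain text (the block files carry no `cite` markers: a cited parameterless `Prop` would be relocated to `Literature/` by the gate).
THE OTHER THREE CONJUNCTS (all kernel-checked, NO hypothesis; lattice statements; radii / windows are where BOUNDS close, not transitions):
* **T37** (strong coupling, WILSON ACTION `W = 0`, seat rb-p2): `SU(2)`, `d = 4`, every `0 < β_W ≤ 9/25`: there is ONE state — the infinite-volume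
  limit of the torus Wilson states, the only limit point and the only DLR state — with `MassGapAt 4 2 (β_W/4)` AND confinement `IsConfining μ χ₂`
  (`RobustBall.WilsonStringTension.su2_oneState_massive_confining`); and for every `N ≥ 2`, `d ≥ 2`, `β > 0`, every limit point of the `SU(N)`
  torus Wilson states obeys Wilson's JOINT string-tension formula `−log|W(R,T)|/(RT) → σ` as `(R,T) → ∞` jointly
  (`RobustBall.WilsonStringTensionJoint.hasStringTension'`). Not about non-Wilson members of the Y2 balls.
* **T38** (track Y2, seat ds-3: ONE STATE ON THE GAUGE-INVARIANT BALL = the van Hove join): (i) every `d`, `N`, `β`, every `ℤ^d` link potential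
  with continuous gauge-invariant finite-range terms: every infinite-volume limit point of the perturbed torus states of its PERIODISED family is a
  DLR state of its `ℤ^d` specification; (ii) `ℤ⁴`, every `N ≥ 1`: a `MassGapOnBallZdG` row + an `AreaLawOnBall` row on the same ball ⇒ every member
  has ONE state (unique DLR state = limit of its periodised torus states), massive with plaquette decay and an area-law bound with ONE `(C, c)` per
  range; (iii) `SU(2)` every `0 ≤ β_W ≤ 1/3` on `MemBallZdG (3/125) (3/250) R`; (iv) every `N ≥ 2` at 't Hooft `1/64` on `MemBallZdG (1/10) (1/10) R`;
  (v) `SU(3)` at `β_W = 1/4` on `MemBallZdG (19/500) (19/1000) R` (eigen modulus, no H1/H2). `σ`-EXISTENCE for non-Wilson members is NOT claimed.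
* **T39** (track (b), seat lit-2): Tomboulis's LOWER bounds Prop. III.2 (3.7) / IV.4 (4.13) (arXiv:0707.2179) for EVERY decimation parameter `b ≥ 2`
  — incl. the census's `b = 2` steps — on every coarse torus `(ℤ/L)^d`, `d ≥ 3`, `L ≥ 2`, `bL` even, every `J`, every plane, for admissible `c`
  with `f_c ≥ 0`; and the axial-gauge FOREST IDENTITY `∫ ∏_{p ∈ 𝔉} f_c(U_p) dU = 1` for EVERY real `c`. Finite tori; the typed `DecimationLowerBound`
  over ALL admissible `c` (sign-changing truncations) is NOT asserted; nothing about (5.15)/(5.16), limits or confinement.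
-/


noncomputable section

namespace Summit.Ventures.YMGap

section T29sec
open MeasureTheory
open Literature.MathematicalPhysics.QuantumLattice Literature.MathematicalPhysics.QuantumFieldTheory
open Balaban1985CMP102 Balaban1985CMP102.Setting Balaban1985CMP102.Theorems
open Summit.QuantumFields.Balaban3D.Carriers (suGroupModel)
open Summit.Ventures.YMGap.YM3IR Summit.Ventures.YMGap.YM3IR.CarrierBridge

/-- **T29, part (A) — track Y4: the `SU(2)` YM₃ INFRARED INTERFACE, KERNEL-CHECKED.** (i) For Bałaban's block size `L`,
any construction `mk` satisfying his CMP 102 Theorems 1–2 as printed (`BalabanUV3 mk`), any terminal spacing `eps0` with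
the printed family inhabited, any finite range `r` and constants `C_b, κ > 0`: the ONE named infrared conjecture
`IRConjecture3` (NOT in print: some block family enters Y2's certified tier-1 ball `ClusterDomainFR (23/50) (23/100) r`
below the TREE ceiling `1/16` (Wilson `β_W = 1/8`) with a linear block factor AND its fluctuation field decouples) implies `MassGap3Cofinal` —
volume-uniform exponential clustering of the `d = 3` `SU(2)` Wilson laws at rate `m₀/β` along the cofinal tori — on
Bałaban's coupling set; Y2's input is the certified row `RobustBall.su2_clusterDomainClustering_dim3_oneEighth`.
(ii) HONEST LABEL, itself kernel-checked: for every unbounded coupling set `I`, `(∃ C_b κ > 0, IRConjecture3 …) ↔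
MassGap3Cofinal I …` (forest / star-decimation witness) — AS TYPED over a free measurable block family the conjecture is a
DICTIONARY for the lattice mass gap, so (i) is a typed INTERFACE between the UV track, track Y2 and the infrared problem,
NOT a reduction of the gap, and `BalabanUV3` is logically idle in it. (Bałaban, CMP 102 (1985): Thm 1 p. 257, Thm 2 p. 272.) -/
def T29A_YM3InfraredInterface : Prop :=
  (∀ (L : ℕ) (mk : Construction L) (eps0 : ℝ → ℝ), Nonempty (Family L eps0) → ∀ (r : ℕ) (C_b κ : ℝ),
      0 < C_b → 0 < κ → BalabanUV3 mk →
      IRConjecture3 (ballOfRobustBallFR 2 (23 / 50) (23 / 100) r (1 / 16)) suFrobDist (fundamentalRep (Fin 2))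
        (balabanCouplings L (suGroupModel 2) eps0) C_b κ →
      MassGap3Cofinal (balabanCouplings L (suGroupModel 2) eps0) suFrobDist
        (fundamentalRep (Fin 2) : RobustBall.SUN 2 →* Matrix (Fin 2) (Fin 2) ℂ)) ∧
  (∀ (r : ℕ) (I : Set ℝ), ¬ BddAbove I →
      ((∃ C_b κ : ℝ, 0 < C_b ∧ 0 < κ ∧
          IRConjecture3 (ballOfRobustBallFR 2 (23 / 50) (23 / 100) r (1 / 16)) suFrobDist (fundamentalRep (Fin 2)) I C_b κ)
        ↔ MassGap3Cofinal I suFrobDist (fundamentalRep (Fin 2) : RobustBall.SUN 2 →* Matrix (Fin 2) (Fin 2) ℂ)))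

/-- T29A holds (`YM3IR.massGap3Cofinal_su2_balaban_of_irConjecture3`, `YM3IR.su2_irConjecture3_iff_massGap3Cofinal`). -/
theorem T29A_YM3InfraredInterface_holds : T29A_YM3InfraredInterface :=
  ⟨fun _ _ _ hfam r _ _ hC hκ hUV hIR => massGap3Cofinal_su2_balaban_of_irConjecture3 hfam r hC hκ hUV hIR,
    fun r _ hI => su2_irConjecture3_iff_massGap3Cofinal r hI⟩

/-- **T29, part (B) — track Y4: the COVARIANT SUFFICIENT CONDITION for the `SU(2)` YM₃ lattice mass gap,
KERNEL-CHECKED.** (i) `BalabanUV3 mk` (print) and `IRConjecture3Cov` — ONE block family that is GAUGE-COVARIANT (Bałaban,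
CMP 98 (11) p.19) and BLOCK-LOCAL (a property of his average (15) p.19; tree axiom `Setup.Averaging.local_dep`; no numbered display) whose coarse laws enter ds-2's hypothesis-free TIER-2 ball
`ClusterDomain (log 6/5) (9/25) (9/50)` below the TREE ceiling `1/16` (Wilson `β_W = 1/8`) with a linear block factor and whose fluctuation field
decouples (NOT in print) — imply `MassGap3Cofinal` on Bałaban's coupling set (Y2's input:
`RobustBall.su2_clusterDomainClusteringW_dim3_oneEighth_w65`).  (ii) The two kernel edges of the covariance clause on
Bałaban's couplings: the forest / star-decimation family (under which the UNPINNED conjecture is target-equivalent) is NOT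
gauge-covariant, the axial straight-line transport IS.  (iii) On the SAME tier-2 ball, for EVERY unbounded coupling set, the UNPINNED
hypothesis `∃ C_b κ > 0, IRConjecture3 …` is EQUIVALENT to `MassGap3Cofinal` (`YM3IR/ForestWitnessSUN.lean`,
`su2_W_irConjecture3_iff_massGap3Cofinal`) — so the covariance / block-locality pin is EXACTLY what (i) adds over a
restatement of the target.  HONEST LABEL: a SUFFICIENT condition — its converse (Gibbsian
restoration / constrained strong mixing for block-constrained gauge measures) is not known and not in print for gauge
theories — never «the remaining gap»; `BalabanUV3` is not yet load-bearing in the arrow (clause (a) is asserted, not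
derived from Thm 2's terminal format). (Bałaban, CMP 102 (1985): Thm 1 p. 257, Thm 2 p. 272; CMP 98 (1985): (11), (15) p. 19.) -/
def T29B_YM3CovariantSufficient : Prop :=
  (∀ (L : ℕ) (mk : Construction L) (eps0 : ℝ → ℝ), Nonempty (Family L eps0) → ∀ (C_b κ : ℝ),
      0 < C_b → 0 < κ → BalabanUV3 mk →
      IRConjecture3Cov (ballOfRobustBall 2 (Real.log (6 / 5)) (9 / 25) (9 / 50) (1 / 16)) suFrobDist
        (fundamentalRep (Fin 2)) (balabanCouplings L (suGroupModel 2) eps0) C_b κ →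
      MassGap3Cofinal (balabanCouplings L (suGroupModel 2) eps0) suFrobDist
        (fundamentalRep (Fin 2) : RobustBall.SUN 2 →* Matrix (Fin 2) (Fin 2) ℂ)) ∧
  (∀ (L : ℕ) (eps0 : ℝ → ℝ) (b : ℝ → ℕ) (hb : ∀ β, 0 < b β) (β : ℝ),
      β ∈ balabanCouplings L (suGroupModel 2) eps0 → 2 ≤ b β →
      ¬ (forestFamily (G := RobustBall.SUN 2) b hb).IsGaugeCovariantOn (balabanCouplings L (suGroupModel 2) eps0) ∧
        (axialFamily (G := RobustBall.SUN 2) b hb).IsGaugeCovariantOn (balabanCouplings L (suGroupModel 2) eps0)) ∧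
  (∀ (I : Set ℝ), ¬ BddAbove I →
      ((∃ C_b κ : ℝ, 0 < C_b ∧ 0 < κ ∧
          IRConjecture3 (ballOfRobustBall 2 (Real.log (6 / 5)) (9 / 25) (9 / 50) (1 / 16)) suFrobDist
            (fundamentalRep (Fin 2)) I C_b κ)
        ↔ MassGap3Cofinal I suFrobDist (fundamentalRep (Fin 2) : RobustBall.SUN 2 →* Matrix (Fin 2) (Fin 2) ℂ)))

/-- T29B holds (`YM3IR.massGap3Cofinal_su2_W_of_irConjecture3Cov`, `YM3IR.su2_covariance_clause_edges`,
`YM3IR.su2_W_irConjecture3_iff_massGap3Cofinal`). -/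
theorem T29B_YM3CovariantSufficient_holds : T29B_YM3CovariantSufficient :=
  ⟨fun _ _ _ hfam _ _ hC hκ hUV hIR => massGap3Cofinal_su2_W_of_irConjecture3Cov hfam hC hκ hUV hIR,
    fun _ _ b hb _ hβ h2 => su2_covariance_clause_edges b hb hβ h2, fun _ hI => su2_W_irConjecture3_iff_massGap3Cofinal hI⟩

/-- **T29 — track Y4: the `SU(2)` YM₃ infrared INTERFACE (part A) and the COVARIANT SUFFICIENT CONDITION (part B) as ONE conjunct**
(candidate C of seat ym3ir-theory-2; typed interface / dictionary, not a reduction; see parts `T29A_YM3InfraredInterface`,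
`T29B_YM3CovariantSufficient`). -/
def T29_YM3Infrared : Prop :=
  T29A_YM3InfraredInterface ∧ T29B_YM3CovariantSufficient

/-- T29 holds (pair of the two part witnesses; hypothesis-free, standard axioms). -/
theorem T29_YM3Infrared_holds : T29_YM3Infrared :=
  ⟨T29A_YM3InfraredInterface_holds, T29B_YM3CovariantSufficient_holds⟩

end T29sec

section T37sec

open MeasureTheory
open Literature.Probability.LatticeModels
open Literature.MathematicalPhysics.QuantumLattice Literature.MathematicalPhysics.QuantumFieldTheory

/-- **T37 — WILSON ACTION (`W = 0`), `SU(2)`, `d = 4`: ONE STATE, MASSIVE AND CONFINING on `0 < β_W ≤ 9/25`; and WILSON'S JOINT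
STRING-TENSION FORMULA at every coupling** (seat rb-p2; a statement about the unperturbed Wilson action and the limit points of ITS torus states —
not about members of the Y2 balls, whose one-state rows are ds-3's texts and do not claim σ-existence): (i) for every Wilson coupling `0 < β_W ≤ 9/25` (tree coupling `β_W/2`, 't Hooft `β_W/4`) there is a state `μ` on
`ℤ⁴` which IS the infinite-volume limit of the torus Wilson states, is the ONLY limit point and the ONLY DLR state, with the mass gap
`MassGapAt 4 2 (β_W/4)` (unique DLR state + exponential clustering) AND confinement `IsConfining μ χ₂` (fundamental string tension exists and is
`> 0`) (`RobustBall.WilsonStringTension.su2_oneState_massive_confining`: T9's uniqueness window joined with T34's confinement window);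
(ii) for every `N ≥ 2`, `d ≥ 2`, `β > 0` and every limit point `μ` of the `SU(N)` torus Wilson states, Wilson's JOINT formula holds:
`−log |W_μ(R,T)|/(RT) → σ(μ)` as `(R,T) → ∞` jointly (`HasStringTension' μ χ_N (stringTension μ χ_N)`;
`RobustBall.WilsonStringTensionJoint.hasStringTension'`). Lattice statements; nothing continuum / spectral. -/
def T37_SU2OneStateMassiveConfining : Prop :=
  (∀ βW : ℝ, 0 < βW → βW ≤ 9 / 25 →
      ∃ μ : Measure (LGConfig 4 (RobustBall.SUN 2)),
        Literature.MathematicalPhysics.QuantumLattice.IsInfiniteVolumeLimit (fundamentalRep (Fin 2)) (βW / 2) μ ∧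
          infiniteVolumeLimitPoints (d := 4) (fundamentalRep (Fin 2)) (βW / 2) = {μ} ∧
          ymGibbsMeasures (d := 4) (fundamentalRep (Fin 2)) (βW / 2) = {μ} ∧
          MassGapAt 4 2 (βW / 4) ∧ IsConfining μ (fun g => normalisedCharacter 2 (fundamentalRep (Fin 2) g))) ∧
    (∀ (d N : ℕ) [NeZero d], 2 ≤ N → 2 ≤ d → ∀ β : ℝ, 0 < β →
      ∀ μ ∈ infiniteVolumeLimitPoints (d := d) (fundamentalRep (Fin N)) β,
        HasStringTension' μ (fun g => normalisedCharacter N (fundamentalRep (Fin N) g))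
          (stringTension μ (fun g => normalisedCharacter N (fundamentalRep (Fin N) g))))

/-- T37 holds. -/
theorem T37_SU2OneStateMassiveConfining_holds : T37_SU2OneStateMassiveConfining :=
  ⟨fun _ hβ hle => RobustBall.WilsonStringTension.su2_oneState_massive_confining hβ hle,
    fun _ N _ hN hd _ hβ _ hμ =>
      RobustBall.WilsonStringTensionJoint.hasStringTension' (fundamentalRep (Fin N))
        (TorusAreaLaw.isSpecialUnitaryModel_fundamentalRep N) hN hd hβ hμ⟩

end T37sec

section T38sec

open MeasureTheory Filter Topology
open Literature.Probability.LatticeModels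
open Literature.MathematicalPhysics.QuantumLattice (fundamentalRep plaquetteCorrFn ZdEdge LGConfig IsZdGaugeInvariant HasAreaLawWith
  normalisedCharacter IsCylinder toTorusObservable)
open Literature.Barriers.QuantumFields (IsMassiveState)
open Summit.Ventures.YMGap.RobustBall

/-- **T38 — track Y2: ONE STATE ON THE GAUGE-INVARIANT BALL (the van Hove join), HYPOTHESIS-FREE** (seat ds-3; `ℤ^d` link potentials with
continuous gauge-invariant terms, locally finite support of range `R`; `perturbedLimitPoints` = infinite-volume limit points of the perturbed
torus states of the PERIODISED family, `perturbedGibbsMeasures` = DLR states of the `ℤ^d` specification): (i) every `d`, `N`, `β`: every limit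
point of the periodised torus states IS a DLR state (`RobustBall.mem_perturbedGibbsMeasures_of_mem_perturbedLimitPoints`); (ii) `ℤ⁴`, every
`N ≥ 1`: a mass-gap row `MassGapOnBallZdG 4 N β ε₀ ε₁ R` and an area-law row `AreaLawOnBall N 4 (Nβ) ε₀ ε₁ R (2R+1)` on the same ball give ONE
`(C, c)`, `c > 0`, such that every member has ONE state — its unique DLR state = the limit of its periodised torus states — MASSIVE with
plaquette–plaquette decay AND `HasAreaLawWith μ χ_N C c` (`RobustBall.oneState_onBallZdG`); (iii) `SU(2)`, EVERY `0 ≤ β_W ≤ 1/3`, ball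
`MemBallZdG (3/125) (3/250) R`: one state, massive + decay + area law, one `(C, c)` per `R` (`RobustBall.su2_oneState_star_upTo_oneThird`);
(iv) every `N ≥ 2` at 't Hooft `1/64` on `MemBallZdG (1/10) (1/10) R` (`RobustBall.suN_oneState_1_64`); (v) `SU(3)` at `β_W = 1/4` on
`MemBallZdG (19/500) (19/1000) R`, eigen modulus, no H1/H2 (`RobustBall.su3_oneState_star_oneQuarter`). Lattice statements about members of the
tier-1 gauge-invariant ball; radii are door artefacts; `σ`-existence for non-Wilson members is NOT claimed (area-law BOUND only); nothing continuum. -/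
def T38_OneStateOnBall : Prop :=
  (∀ (d N : ℕ) (W : Potential (ZdEdge d) (Matrix.specialUnitaryGroup (Fin N) ℂ))
      (supp : Finset (ZdEdge d) → Finset (Finset (ZdEdge d)))
      (hdep : ∀ X, DependsOn (W X) (↑X : Set (ZdEdge d))) (hg : ∀ X, IsZdGaugeInvariant (W X))
      (hm : ∀ X, Measurable (W X)) (hb : ∀ X, ∃ C, ∀ U, |W X U| ≤ C),
      W.IsSupportedBy supp → (∀ X, Continuous (W X)) →
      ∀ R : ℝ, (∀ e, ∀ X ∈ supp {e}, e ∈ X → ∀ y ∈ X, ‖e.1 - y.1‖ ≤ R) →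
      ∀ (β : ℝ) (μ : Measure (LGConfig d (Matrix.specialUnitaryGroup (Fin N) ℂ))),
        μ ∈ perturbedLimitPoints β (periodisedFamily W supp hdep hg hm hb) →
          μ ∈ perturbedGibbsMeasures (d := d) (fundamentalRep (Fin N)) β W supp) ∧
  (∀ N : ℕ, 1 ≤ N → ∀ (β ε₀ ε₁ : ℝ) (R : ℕ), 0 ≤ ε₀ → 0 ≤ ε₁ →
      MassGapOnBallZdG 4 N β ε₀ ε₁ R → AreaLawOnBall N 4 ((N : ℝ) * β) ε₀ ε₁ R (2 * R + 1) →
      ∃ C c : ℝ, 0 < c ∧ ∀ (W : Potential (ZdEdge 4) (Matrix.specialUnitaryGroup (Fin N) ℂ))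
        (supp : Finset (ZdEdge 4) → Finset (Finset (ZdEdge 4)))
        (hmem : MemBallZdG ε₀ ε₁ R W supp) (hdep : ∀ X, DependsOn (W X) (↑X : Set (ZdEdge 4)))
        (hg : ∀ X, IsZdGaugeInvariant (W X)) (hm : ∀ X, Measurable (W X)) (hb : ∀ X, ∃ C, ∀ U, |W X U| ≤ C),
        ∃ μ : Measure (LGConfig 4 (Matrix.specialUnitaryGroup (Fin N) ℂ)),
          perturbedGibbsMeasures (d := 4) (fundamentalRep (Fin N)) ((N : ℝ) * β) W supp = {μ} ∧
          perturbedLimitPoints ((N : ℝ) * β) (periodisedFamily W supp hdep hg hm hb) = {μ} ∧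
          IsMassiveState μ ∧ HasExponentialDecay (plaquetteCorrFn (fundamentalRep (Fin N)) μ) ∧
          HasAreaLawWith μ (fun g => normalisedCharacter N (fundamentalRep (Fin N) g)) C c) ∧
  (∀ R : ℕ, ∃ C c : ℝ, 0 < c ∧ ∀ βW : ℝ, 0 ≤ βW → βW ≤ 1 / 3 →
      ∀ (W : Potential (ZdEdge 4) (Matrix.specialUnitaryGroup (Fin 2) ℂ))
        (supp : Finset (ZdEdge 4) → Finset (Finset (ZdEdge 4)))
        (hmem : MemBallZdG (3 / 125) (3 / 250) R W supp) (hdep : ∀ X, DependsOn (W X) (↑X : Set (ZdEdge 4)))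
        (hg : ∀ X, IsZdGaugeInvariant (W X)) (hm : ∀ X, Measurable (W X)) (hb : ∀ X, ∃ C, ∀ U, |W X U| ≤ C),
        ∃ μ : Measure (LGConfig 4 (Matrix.specialUnitaryGroup (Fin 2) ℂ)),
          perturbedGibbsMeasures (d := 4) (fundamentalRep (Fin 2)) (((2 : ℕ) : ℝ) * (βW / 4)) W supp = {μ} ∧
          perturbedLimitPoints (((2 : ℕ) : ℝ) * (βW / 4)) (periodisedFamily W supp hdep hg hm hb) = {μ} ∧
          IsMassiveState μ ∧ HasExponentialDecay (plaquetteCorrFn (fundamentalRep (Fin 2)) μ) ∧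
          HasAreaLawWith μ (fun g => normalisedCharacter 2 (fundamentalRep (Fin 2) g)) C c) ∧
  (∀ N : ℕ, 2 ≤ N → ∀ R : ℕ, ∃ C c : ℝ, 0 < c ∧
      ∀ (W : Potential (ZdEdge 4) (Matrix.specialUnitaryGroup (Fin N) ℂ))
        (supp : Finset (ZdEdge 4) → Finset (Finset (ZdEdge 4)))
        (hmem : MemBallZdG (1 / 10) (1 / 10) R W supp) (hdep : ∀ X, DependsOn (W X) (↑X : Set (ZdEdge 4)))
        (hg : ∀ X, IsZdGaugeInvariant (W X)) (hm : ∀ X, Measurable (W X)) (hb : ∀ X, ∃ C, ∀ U, |W X U| ≤ C),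
        ∃ μ : Measure (LGConfig 4 (Matrix.specialUnitaryGroup (Fin N) ℂ)),
          perturbedGibbsMeasures (d := 4) (fundamentalRep (Fin N)) ((N : ℝ) * (1 / 64)) W supp = {μ} ∧
          perturbedLimitPoints ((N : ℝ) * (1 / 64)) (periodisedFamily W supp hdep hg hm hb) = {μ} ∧
          IsMassiveState μ ∧ HasExponentialDecay (plaquetteCorrFn (fundamentalRep (Fin N)) μ) ∧
          HasAreaLawWith μ (fun g => normalisedCharacter N (fundamentalRep (Fin N) g)) C c) ∧
  (∀ R : ℕ, ∃ C c : ℝ, 0 < c ∧ ∀ (W : Potential (ZdEdge 4) (Matrix.specialUnitaryGroup (Fin 3) ℂ))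
        (supp : Finset (ZdEdge 4) → Finset (Finset (ZdEdge 4)))
        (hmem : MemBallZdG (19 / 500) (19 / 1000) R W supp) (hdep : ∀ X, DependsOn (W X) (↑X : Set (ZdEdge 4)))
        (hg : ∀ X, IsZdGaugeInvariant (W X)) (hm : ∀ X, Measurable (W X)) (hb : ∀ X, ∃ C, ∀ U, |W X U| ≤ C),
        ∃ μ : Measure (LGConfig 4 (Matrix.specialUnitaryGroup (Fin 3) ℂ)),
          perturbedGibbsMeasures (d := 4) (fundamentalRep (Fin 3)) (((3 : ℕ) : ℝ) * ((1 / 4 : ℝ) / 9)) W supp = {μ} ∧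
          perturbedLimitPoints (((3 : ℕ) : ℝ) * ((1 / 4 : ℝ) / 9)) (periodisedFamily W supp hdep hg hm hb) = {μ} ∧
          IsMassiveState μ ∧ HasExponentialDecay (plaquetteCorrFn (fundamentalRep (Fin 3)) μ) ∧
          HasAreaLawWith μ (fun g => normalisedCharacter 3 (fundamentalRep (Fin 3) g)) C c)

/-- T38 holds (`mem_perturbedGibbsMeasures_of_mem_perturbedLimitPoints`, `oneState_onBallZdG`, `su2_oneState_star_upTo_oneThird`,
`suN_oneState_1_64`, `su3_oneState_star_oneQuarter`; seat ds-3 g10 texts 53661762a1ee1cfb). -/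
theorem T38_OneStateOnBall_holds : T38_OneStateOnBall :=
  ⟨fun _ _ _ _ hdep hg hm hb hsupp hWc _ hrange β _ hμ =>
      mem_perturbedGibbsMeasures_of_mem_perturbedLimitPoints hdep hg hm hb hsupp hWc hrange β hμ,
    fun _ hN _ _ _ _ hε₀ hε₁ hgap hAL => oneState_onBallZdG hN hε₀ hε₁ hgap hAL,
    fun R => su2_oneState_star_upTo_oneThird R, fun _ hN R => suN_oneState_1_64 hN R,
    fun R => su3_oneState_star_oneQuarter R⟩

end T38sec

section T39sec

open MeasureTheory Finset
open Literature.MathematicalPhysics.QuantumLattice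
open Literature.MathematicalPhysics.QuantumFieldTheory
open Literature.MathematicalPhysics.QuantumFieldTheory.Tomboulis2007

/-- **T39 — track (b): Tomboulis's LOWER bounds III.2 (3.7) / IV.4 (4.13) FOR EVERY DECIMATION PARAMETER `b ≥ 2` on the positivity
domain, and the axial-gauge forest identity, UNCONDITIONAL** — (i) III.2: `d ≥ 3`, `b ≥ 2`, coarse side `L ≥ 2`, `bL` even, every `J`,
admissible `c` with `f_c ≥ 0`: `Z_{(ℤ/L)^d}({c_j^6}) ≤ Z_{(ℤ/bL)^d}({c_j})` (`Census.decimationLowerBound_of_nonneg`; NEW for `b = 2` in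
`d = 3, 4, 5`); (ii) IV.4: the same for `Z⁺` with the twist on the vortex sheet `𝒱_{ij}`, every plane `i < j`
(`Census.decimationLowerBoundPlus_of_nonneg'`); (iii) the forest identity: for the plaquette forest `𝔉 = Census.axialForest d L`
(`#𝔉 = (d−1)L^d − (L + ⋯ + L^{d−1})`), `∫ ∏_{p ∈ 𝔉} f_c(U_p) ∏_e dU_e = 1` for every `d`, every `L ≥ 2`, every `J` and EVERY real `c`
(`Census.integral_prod_axialForest`).  Finite tori; nothing about sign-changing truncations, (5.15)/(5.16), limits or confinement.
Texts: seat lit-2. -/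
def T39_TomboulisLowerBoundsEveryB : Prop :=
  (∀ (d L b : ℕ) [NeZero L] [Fact (1 < L)] [NeZero (b * L)], 3 ≤ d → 2 ≤ b → Even (b * L) →
      ∀ (J : ℕ) (c : ℕ → ℝ), CoeffAdmissible c → (∀ g : Tomboulis2007.SU2, 0 ≤ plaqFn J c g) →
        torusZ d L J (lowerCoeff c) ≤ torusZ d (b * L) J c) ∧
    (∀ (d L b : ℕ) [NeZero L] [Fact (1 < L)] [NeZero (b * L)], 3 ≤ d → 2 ≤ b → Even (b * L) →
      ∀ (J : ℕ) (i j : Fin d) (hij : i < j) (c : ℕ → ℝ), CoeffAdmissible c → (∀ g : Tomboulis2007.SU2, 0 ≤ plaqFn J c g) →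
        torusZplus d L J (lowerCoeff c) (vortexSheet L i j hij) ≤ torusZplus d (b * L) J c (vortexSheet (b * L) i j hij)) ∧
    (∀ (d L : ℕ) [NeZero L] [Fact (1 < L)] (J : ℕ) (c : ℕ → ℝ),
      ∫ W, ∏ p ∈ Census.axialForest d L, plaqFn J c (plaquetteHolonomy W p.1 p.2.1.1 p.2.1.2)
        ∂(Measure.pi fun _ : Edge d L => haarProbability Tomboulis2007.SU2) = 1)

/-- T39 holds (`Census.decimationLowerBound_of_nonneg`, `Census.decimationLowerBoundPlus_of_nonneg'`, `Census.integral_prod_axialForest`). -/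
theorem T39_TomboulisLowerBoundsEveryB_holds : T39_TomboulisLowerBoundsEveryB :=
  ⟨fun _ _ _ _ _ _ hd hb hbL J _ hc hf => Census.decimationLowerBound_of_nonneg hd hb hbL J hc hf,
    fun _ _ _ _ _ _ hd hb hbL J _ _ hij _ hc hf => Census.decimationLowerBoundPlus_of_nonneg' hd hb hbL J hij hc hf,
    fun _ _ _ _ J c => Census.integral_prod_axialForest J c⟩

end T39sec

end Summit.Ventures.YMGap

end
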